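import Summits.HodgeConjecture.HodgeConjecture.Theorems.Ring2WeilCoverageWeilGramLevel21Principal
import Summits.HodgeConjecture.HodgeConjecture.Theorems.Ring2WeilCoverageRamifiedTypesLevels21and28
import HarnessLib

/-!
# Weil-type family coverage — THE COMPONENTS OF THE WEIL-TYPE `ℤ[ζ₂₁]`-SIXFOLDS, IV: the RAMIFIED type `𝔮₃`
# (`π₃ = ζ¹⁷(1 − ζ⁷)(1 − ζ)`, `(𝔬𝔣₀)² = (3)`, degree `27`) against `√−3`: Gram determinant `−46656 = −216²` — RIGHT
# sign, SPLIT class: the type-`𝔮₃` polarised Weil-type `ℤ[ζ₂₁]`-sixfolds lie on row R0 for `ℚ(√−3)` (census W6.3.1)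

research route conditional on HC_CM; not a corollary; Q11.4-sentence-2 already refuted in dim ≥ 3.

Ring 2, WEIL-TYPE FAMILY-COVERAGE CENSUS (`HOME/WEIL-FAMILY-COVERAGE.md` `## b01`, block b01.41 (B)/(C): «`(21, √−3)`:
type `𝔮₃`, degree `27 ≡ 1`: SPLIT (= b01.17 `X₂₁`)», S-pencil there), part 101 of the `Ring2WeilCoverage*` series;
continues parts 98/99.  Part 49a (`Ring2WeilCoverageRamifiedTypesLevels21and28`) proved that EVERY `ℚ(√−3)`-balanced
CM type `Φ` of `ℚ(ζ₂₁)` carries a `Φ`-positive divisor of type `𝔣₀`, `𝔬𝔣₀ = (π₃)`.  Here: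

* §1 the eleven traces `Tr(π₃ξ s₃ θ^m)` and the Gram datum: **`det a(π₃ξ) = −46656 = −216²`**
  (`= N_{K⁺/ℚ}(π₃)·det a(ξ) = (−27)·1728`: part 82's component rule in numbers; `N(π₃) < 0` is the flip).
* §2 **for EVERY skew `ζ′` of type `𝔮₃` on `ℤ[ζ₂₁]` the determinant is `−46656`** (part 82 + THEOREM L (i) at `21`);
  CENSUS FORM (existence from part 49a + determinant); class **`[−46656] = [−1]·[216²] = splitDiscriminantClass 3 3`**:
  **the type-`𝔮₃` polarised Weil-type `ℤ[ζ₂₁]`-sixfolds — which exist on EVERY `ℚ(√−3)`-balanced `Φ` — lie on the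
  SPLIT component**, pub-hsemireg row R0 for `ℚ(√−3)` (census W6.3.1); b01.17's `X₂₁` with `(1,1,1,3,3,3)` is one.

HONEST FRAMING as parts 98/99; `HC_CM` is used nowhere.  No `def`, no named fact, no `sorry`.  Certificates from
`work/py/gen6.py` + `lev21.py`, re-verified by `linear_combination`.

References: [cite: vanGeemen1994HodgeAV, Lemma 5.2 (2)–(4), 5.4 and (5.4.1)]; [cite: Shimura1998, §14.3 Prop. 4–5,
pp. 103–104]; census b01.17, b01.41 (B)/(C) (seat-derived).
-/

noncomputable section

open Polynomial NumberField Module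
open scoped nonZeroDivisors

namespace Summit.HodgeConjecture.Ring2WeilCoverage.WeilGramLevel21TypeThree

open Literature.AlgebraicGeometry.VanGeemen1994 (weilField weilNormResidueGroup)
open Literature.AlgebraicGeometry.Motives (CMType normUnitsSubgroup)
open Literature.NumberTheory.ComplexMultiplication
open Summit.HodgeConjecture.Ring2WeilCoverage.TraceGramDeterminant (trace_aeval_zeta_mul_inv)
open Summit.HodgeConjecture.Ring2WeilCoverage.WeilGramCMPoint
open Summit.HodgeConjecture.Ring2WeilCoverage.RealUnitNormHalfSystems (complexConj_eq_inv)
open Summit.HodgeConjecture.Ring2WeilCoverage.CyclotomicPrincipalObstruction (complexConj_xi)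
open Summit.HodgeConjecture.Ring2WeilCoverage.CyclotomicDifferent (isOfType_one_xi_top xi_ne_zero)
open Summit.HodgeConjecture.HodgeConjecture.Ring2.WeilCoverage (mk_neg_eq_split_of_odd mk_neg_ne_split_of_odd
  mem_normUnitsSubgroup_of_sq_add_mul_sq)
open Summit.HodgeConjecture.HodgeConjecture.Ring2.Hypotheses (splitDiscriminantClass)
open Summit.HodgeConjecture.Ring2WeilCoverage.WeilGramLevel21
open Summit.HodgeConjecture.Ring2WeilCoverage.WeilGramLevel21Principal
open Summit.HodgeConjecture.Ring2WeilCoverage.RealQuadraticUnitNorm (norm_realUnits_pos_twentyOne)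
open Summit.HodgeConjecture.Ring2WeilCoverage.RamifiedTypes (isOfType_one_gen_mul_xi complexConj_gen_mul_xi gen_ne_zero)
open Summit.HodgeConjecture.Ring2WeilCoverage.RamifiedTypesLevels21and28 (adm_twentyOne exists_type_twentyOne_sqrt_neg_three)
variable {K : Type} [Field K] [NumberField K] {ζ : K}

/-- `𝐞(t) = exp(2πi t/n) ∈ ℂ` (`ZMod.toCircle`). -/
local notation3 (prettyPrint := false) "𝐞 " t:max => ((ZMod.toCircle t : Circle) : ℂ)

/-- the residue set `S_Φ` read at level `21`. -/
local notation3 (prettyPrint := false) "SΦ[" Φ "," z "]" =>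
  (Finset.univ.filter fun t : ZMod 21 => ∃ σ ∈ (Φ : CMType K).1, σ (z : K) = 𝐞 t)

/-! ### §1 Type `𝔮₃`: `ζ′ = π₃ξ` — eleven traces, `det a = −46656` -/

/-- `Tr(ζ′sθ^0) = 0` for `ζ′ = π₃ξ, π₃ = ζ¹⁷(1 − ζ⁷)(1 − ζ)`, `s = √−3 = 1 + 2ζ⁷`, `θ = ζ + ζ⁻¹` (Euler evaluation). research route conditional on HC_CM; not a corollary; Q11.4-sentence-2 already refuted in dim ≥ 3. [folklore] -/
theorem trace_piThree_sqrtNegThree_zero [IsCyclotomicExtension {21} ℚ K] (hζ : IsPrimitiveRoot ζ 21) :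
    Algebra.trace ℚ K ((ζ ^ 17 * (1 - ζ ^ 7) * (1 - ζ) * (ζ ^ 5 * (aeval ζ (derivative (cyclotomic 21 ℚ)))⁻¹)) * (1 + 2 * ζ ^ 7)) = 0 := by
  have h21 : ζ ^ 21 = 1 := hζ.pow_eq_one
  have hΦ := cyc_twentyOne hζ
  rw [trace_of_key₀ hζ (C (0 : ℚ) + C (3 : ℚ) * X + C (-3 : ℚ) * X ^ 2 + C (0 : ℚ) * X ^ 3 + C (0 : ℚ) * X ^ 4 + C (0 : ℚ) * X ^ 5 +
      C (0 : ℚ) * X ^ 6 + C (0 : ℚ) * X ^ 7 + C (3 : ℚ) * X ^ 8 + C (-3 : ℚ) * X ^ 9 + C (0 : ℚ) * X ^ 10 +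
      C (0 : ℚ) * X ^ 11) (by compute_degree) (by
    rw [aeval_poly₁₂]
    push_cast
    linear_combination ((aeval ζ (derivative (cyclotomic 21 ℚ)))⁻¹ * (-2 * ζ + 2 * ζ^4)) * hΦ +
      ((aeval ζ (derivative (cyclotomic 21 ℚ)))⁻¹ * (ζ - ζ^2 + ζ^8 - ζ^9 - 2 * ζ^15 + 2 * ζ^16)) * h21)]
  norm_num [coeff_X_pow, coeff_X, coeff_C, coeff_one]

/-- `Tr(ζ′sθ^1) = 0` for `ζ′ = π₃ξ, π₃ = ζ¹⁷(1 − ζ⁷)(1 − ζ)`, `s = √−3 = 1 + 2ζ⁷`, `θ = ζ + ζ⁻¹` (Euler evaluation). research route conditional on HC_CM; not a corollary; Q11.4-sentence-2 already refuted in dim ≥ 3. [folklore] -/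
theorem trace_piThree_sqrtNegThree_one [IsCyclotomicExtension {21} ℚ K] (hζ : IsPrimitiveRoot ζ 21) :
    Algebra.trace ℚ K ((ζ ^ 17 * (1 - ζ ^ 7) * (1 - ζ) * (ζ ^ 5 * (aeval ζ (derivative (cyclotomic 21 ℚ)))⁻¹)) * (1 + 2 * ζ ^ 7) * (ζ + ζ⁻¹)) = 0 := by
  have h21 : ζ ^ 21 = 1 := hζ.pow_eq_one
  have hΦ := cyc_twentyOne hζ
  rw [trace_of_key₁ hζ (C (3 : ℚ) + C (-3 : ℚ) * X + C (3 : ℚ) * X ^ 2 + C (-3 : ℚ) * X ^ 3 + C (0 : ℚ) * X ^ 4 +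
      C (0 : ℚ) * X ^ 5 + C (0 : ℚ) * X ^ 6 + C (3 : ℚ) * X ^ 7 + C (-3 : ℚ) * X ^ 8 + C (3 : ℚ) * X ^ 9 +
      C (-3 : ℚ) * X ^ 10 + C (0 : ℚ) * X ^ 11) (by compute_degree) (by
    rw [aeval_poly₁₂]
    push_cast
    linear_combination ((aeval ζ (derivative (cyclotomic 21 ℚ)))⁻¹ * (-2 * ζ - 2 * ζ^3 + 2 * ζ^4 + 2 * ζ^6)) * hΦ +
      ((aeval ζ (derivative (cyclotomic 21 ℚ)))⁻¹ * (ζ - ζ^2 + ζ^3 - ζ^4 + ζ^8 - ζ^9 + ζ^10 - ζ^11 - 2 * ζ^15 + 2 * ζ^16 -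
        2 * ζ^17 + 2 * ζ^18)) * h21)]
  norm_num [coeff_X_pow, coeff_X, coeff_C, coeff_one]

/-- `Tr(ζ′sθ^2) = -6` for `ζ′ = π₃ξ, π₃ = ζ¹⁷(1 − ζ⁷)(1 − ζ)`, `s = √−3 = 1 + 2ζ⁷`, `θ = ζ + ζ⁻¹` (Euler evaluation). research route conditional on HC_CM; not a corollary; Q11.4-sentence-2 already refuted in dim ≥ 3. [folklore] -/
theorem trace_piThree_sqrtNegThree_two [IsCyclotomicExtension {21} ℚ K] (hζ : IsPrimitiveRoot ζ 21) :
    Algebra.trace ℚ K ((ζ ^ 17 * (1 - ζ ^ 7) * (1 - ζ) * (ζ ^ 5 * (aeval ζ (derivative (cyclotomic 21 ℚ)))⁻¹)) * (1 + 2 * ζ ^ 7) * (ζ + ζ⁻¹) ^ 2) = -6 := by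
  have h21 : ζ ^ 21 = 1 := hζ.pow_eq_one
  have hΦ := cyc_twentyOne hζ
  rw [trace_of_key hζ (C (0 : ℚ) + C (6 : ℚ) * X + C (-9 : ℚ) * X ^ 2 + C (6 : ℚ) * X ^ 3 + C (-3 : ℚ) * X ^ 4 +
      C (-3 : ℚ) * X ^ 5 + C (3 : ℚ) * X ^ 6 + C (0 : ℚ) * X ^ 7 + C (3 : ℚ) * X ^ 8 + C (-6 : ℚ) * X ^ 9 +
      C (6 : ℚ) * X ^ 10 + C (-6 : ℚ) * X ^ 11) (by compute_degree) (by
    rw [aeval_poly₁₂]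
    push_cast
    linear_combination ((aeval ζ (derivative (cyclotomic 21 ℚ)))⁻¹ * (ζ - 4 * ζ^3 + 2 * ζ^4 - 2 * ζ^5 + 4 * ζ^6 + 2 * ζ^8)) * hΦ +
      ((aeval ζ (derivative (cyclotomic 21 ℚ)))⁻¹ * (ζ - ζ^2 + 2 * ζ^3 - 2 * ζ^4 + ζ^5 - ζ^6 + ζ^8 - ζ^9 + 2 * ζ^10 -
        2 * ζ^11 + ζ^12 - ζ^13 - 2 * ζ^15 + 2 * ζ^16 - 4 * ζ^17 + 4 * ζ^18 -
        2 * ζ^19 + 2 * ζ^20)) * h21)]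
  norm_num [coeff_X_pow, coeff_X, coeff_C, coeff_one]

/-- `Tr(ζ′sθ^3) = 0` for `ζ′ = π₃ξ, π₃ = ζ¹⁷(1 − ζ⁷)(1 − ζ)`, `s = √−3 = 1 + 2ζ⁷`, `θ = ζ + ζ⁻¹` (Euler evaluation). research route conditional on HC_CM; not a corollary; Q11.4-sentence-2 already refuted in dim ≥ 3. [folklore] -/
theorem trace_piThree_sqrtNegThree_three [IsCyclotomicExtension {21} ℚ K] (hζ : IsPrimitiveRoot ζ 21) :
    Algebra.trace ℚ K ((ζ ^ 17 * (1 - ζ ^ 7) * (1 - ζ) * (ζ ^ 5 * (aeval ζ (derivative (cyclotomic 21 ℚ)))⁻¹)) * (1 + 2 * ζ ^ 7) * (ζ + ζ⁻¹) ^ 3) = 0 := by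
  have h21 : ζ ^ 21 = 1 := hζ.pow_eq_one
  have hΦ := cyc_twentyOne hζ
  rw [trace_of_key hζ (C (12 : ℚ) + C (-15 : ℚ) * X + C (12 : ℚ) * X ^ 2 + C (-6 : ℚ) * X ^ 3 + C (-3 : ℚ) * X ^ 4 +
      C (0 : ℚ) * X ^ 5 + C (3 : ℚ) * X ^ 6 + C (6 : ℚ) * X ^ 7 + C (-12 : ℚ) * X ^ 8 + C (15 : ℚ) * X ^ 9 +
      C (-12 : ℚ) * X ^ 10 + C (0 : ℚ) * X ^ 11) (by compute_degree) (by
    rw [aeval_poly₁₂]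
    push_cast
    linear_combination ((aeval ζ (derivative (cyclotomic 21 ℚ)))⁻¹ * (-2 + ζ - 7 * ζ^3 + 2 * ζ^4 - 6 * ζ^5 + 6 * ζ^6 + 6 * ζ^8)) * hΦ +
      ((aeval ζ (derivative (cyclotomic 21 ℚ)))⁻¹ * (-2 + 3 * ζ - ζ^2 + 3 * ζ^3 - 3 * ζ^4 + 3 * ζ^5 - 3 * ζ^6 + ζ^7 - ζ^9 +
        3 * ζ^10 - 3 * ζ^11 + 3 * ζ^12 - 3 * ζ^13 + ζ^14 - 3 * ζ^15 + 2 * ζ^16 -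
        6 * ζ^17 + 6 * ζ^18 - 6 * ζ^19 + 6 * ζ^20 - 2 * ζ^21 + 2 * ζ^22)) * h21)]
  norm_num [coeff_X_pow, coeff_X, coeff_C, coeff_one]

/-- `Tr(ζ′sθ^4) = -24` for `ζ′ = π₃ξ, π₃ = ζ¹⁷(1 − ζ⁷)(1 − ζ)`, `s = √−3 = 1 + 2ζ⁷`, `θ = ζ + ζ⁻¹` (Euler evaluation). research route conditional on HC_CM; not a corollary; Q11.4-sentence-2 already refuted in dim ≥ 3. [folklore] -/
theorem trace_piThree_sqrtNegThree_four [IsCyclotomicExtension {21} ℚ K] (hζ : IsPrimitiveRoot ζ 21) :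
    Algebra.trace ℚ K ((ζ ^ 17 * (1 - ζ ^ 7) * (1 - ζ) * (ζ ^ 5 * (aeval ζ (derivative (cyclotomic 21 ℚ)))⁻¹)) * (1 + 2 * ζ ^ 7) * (ζ + ζ⁻¹) ^ 4) = -24 := by
  have h21 : ζ ^ 21 = 1 := hζ.pow_eq_one
  have hΦ := cyc_twentyOne hζ
  rw [trace_of_key hζ (C (-3 : ℚ) + C (24 : ℚ) * X + C (-33 : ℚ) * X ^ 2 + C (21 : ℚ) * X ^ 3 + C (-6 : ℚ) * X ^ 4 +
      C (-12 : ℚ) * X ^ 5 + C (6 : ℚ) * X ^ 6 + C (3 : ℚ) * X ^ 7 + C (9 : ℚ) * X ^ 8 + C (-24 : ℚ) * X ^ 9 +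
      C (27 : ℚ) * X ^ 10 + C (-24 : ℚ) * X ^ 11) (by compute_degree) (by
    rw [aeval_poly₁₂]
    push_cast
    linear_combination ((aeval ζ (derivative (cyclotomic 21 ℚ)))⁻¹ * (-8 + ζ - 2 * ζ^2 + 12 * ζ^3 + 2 * ζ^4 - 13 * ζ^5 + 8 * ζ^6 + 12 * ζ^8)) * hΦ +
      ((aeval ζ (derivative (cyclotomic 21 ℚ)))⁻¹ * (-8 + 9 * ζ - 3 * ζ^2 + 6 * ζ^3 - 4 * ζ^4 + 6 * ζ^5 - 6 * ζ^6 + 4 * ζ^7 -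
        3 * ζ^8 + 3 * ζ^10 - 4 * ζ^11 + 6 * ζ^12 - 6 * ζ^13 + 4 * ζ^14 -
        6 * ζ^15 + 3 * ζ^16 - 9 * ζ^17 + 8 * ζ^18 - 12 * ζ^19 + 12 * ζ^20 -
        8 * ζ^21 + 8 * ζ^22 - 2 * ζ^23 + 2 * ζ^24)) * h21)]
  norm_num [coeff_X_pow, coeff_X, coeff_C, coeff_one]

/-- `Tr(ζ′sθ^5) = 6` for `ζ′ = π₃ξ, π₃ = ζ¹⁷(1 − ζ⁷)(1 − ζ)`, `s = √−3 = 1 + 2ζ⁷`, `θ = ζ + ζ⁻¹` (Euler evaluation). research route conditional on HC_CM; not a corollary; Q11.4-sentence-2 already refuted in dim ≥ 3. [folklore] -/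
theorem trace_piThree_sqrtNegThree_five [IsCyclotomicExtension {21} ℚ K] (hζ : IsPrimitiveRoot ζ 21) :
    Algebra.trace ℚ K ((ζ ^ 17 * (1 - ζ ^ 7) * (1 - ζ) * (ζ ^ 5 * (aeval ζ (derivative (cyclotomic 21 ℚ)))⁻¹)) * (1 + 2 * ζ ^ 7) * (ζ + ζ⁻¹) ^ 5) = 6 := by
  have h21 : ζ ^ 21 = 1 := hζ.pow_eq_one
  have hΦ := cyc_twentyOne hζ
  rw [trace_of_key hζ (C (45 : ℚ) + C (-60 : ℚ) * X + C (48 : ℚ) * X ^ 2 + C (-18 : ℚ) * X ^ 3 + C (-15 : ℚ) * X ^ 4 +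
      C (3 : ℚ) * X ^ 5 + C (15 : ℚ) * X ^ 6 + C (12 : ℚ) * X ^ 7 + C (-42 : ℚ) * X ^ 8 + C (60 : ℚ) * X ^ 9 +
      C (-51 : ℚ) * X ^ 10 + C (6 : ℚ) * X ^ 11) (by compute_degree) (by
    rw [aeval_poly₁₂]
    push_cast
    linear_combination ((aeval ζ (derivative (cyclotomic 21 ℚ)))⁻¹ * (-20 + ζ - 10 * ζ^2 + 25 * ζ^3 - 3 * ζ^4 - 25 * ζ^5 + 10 * ζ^6 - ζ^7 +
        20 * ζ^8)) * hΦ +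
      ((aeval ζ (derivative (cyclotomic 21 ℚ)))⁻¹ * (-20 + 21 * ζ - 11 * ζ^2 + 15 * ζ^3 - 7 * ζ^4 + 12 * ζ^5 - 10 * ζ^6 +
        10 * ζ^7 - 9 * ζ^8 + 4 * ζ^9 - 4 * ζ^11 + 9 * ζ^12 - 10 * ζ^13 +
        10 * ζ^14 - 12 * ζ^15 + 7 * ζ^16 - 15 * ζ^17 + 11 * ζ^18 - 21 * ζ^19 +
        20 * ζ^20 - 20 * ζ^21 + 20 * ζ^22 - 10 * ζ^23 + 10 * ζ^24 - 2 * ζ^25 +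
        2 * ζ^26)) * h21)]
  norm_num [coeff_X_pow, coeff_X, coeff_C, coeff_one]

/-- `Tr(ζ′sθ^6) = -90` for `ζ′ = π₃ξ, π₃ = ζ¹⁷(1 − ζ⁷)(1 − ζ)`, `s = √−3 = 1 + 2ζ⁷`, `θ = ζ + ζ⁻¹` (Euler evaluation). research route conditional on HC_CM; not a corollary; Q11.4-sentence-2 already refuted in dim ≥ 3. [folklore] -/
theorem trace_piThree_sqrtNegThree_six [IsCyclotomicExtension {21} ℚ K] (hζ : IsPrimitiveRoot ζ 21) :
    Algebra.trace ℚ K ((ζ ^ 17 * (1 - ζ ^ 7) * (1 - ζ) * (ζ ^ 5 * (aeval ζ (derivative (cyclotomic 21 ℚ)))⁻¹)) * (1 + 2 * ζ ^ 7) * (ζ + ζ⁻¹) ^ 6) = -90 := by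
  have h21 : ζ ^ 21 = 1 := hζ.pow_eq_one
  have hΦ := cyc_twentyOne hζ
  rw [trace_of_key hζ (C (-21 : ℚ) + C (99 : ℚ) * X + C (-123 : ℚ) * X ^ 2 + C (72 : ℚ) * X ^ 3 + C (-9 : ℚ) * X ^ 4 +
      C (-45 : ℚ) * X ^ 5 + C (9 : ℚ) * X ^ 6 + C (18 : ℚ) * X ^ 7 + C (33 : ℚ) * X ^ 8 + C (-99 : ℚ) * X ^ 9 +
      C (111 : ℚ) * X ^ 10 + C (-90 : ℚ) * X ^ 11) (by compute_degree) (by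
    rw [aeval_poly₁₂]
    push_cast
    linear_combination ((aeval ζ (derivative (cyclotomic 21 ℚ)))⁻¹ * (-41 - 31 * ζ^2 + 46 * ζ^3 - 13 * ζ^4 + 45 * ζ^5 + 13 * ζ^6 - 5 * ζ^7 +
        31 * ζ^8)) * hΦ +
      ((aeval ζ (derivative (cyclotomic 21 ℚ)))⁻¹ * (-41 + 41 * ζ - 31 * ζ^2 + 36 * ζ^3 - 18 * ζ^4 + 27 * ζ^5 - 17 * ζ^6 +
        22 * ζ^7 - 19 * ζ^8 + 14 * ζ^9 - 9 * ζ^10 + 9 * ζ^12 - 14 * ζ^13 +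
        19 * ζ^14 - 22 * ζ^15 + 17 * ζ^16 - 27 * ζ^17 + 18 * ζ^18 - 36 * ζ^19 +
        31 * ζ^20 - 41 * ζ^21 + 40 * ζ^22 - 30 * ζ^23 + 30 * ζ^24 - 12 * ζ^25 +
        12 * ζ^26 - 2 * ζ^27 + 2 * ζ^28)) * h21)]
  norm_num [coeff_X_pow, coeff_X, coeff_C, coeff_one]

/-- `Tr(ζ′sθ^7) = 42` for `ζ′ = π₃ξ, π₃ = ζ¹⁷(1 − ζ⁷)(1 − ζ)`, `s = √−3 = 1 + 2ζ⁷`, `θ = ζ + ζ⁻¹` (Euler evaluation). research route conditional on HC_CM; not a corollary; Q11.4-sentence-2 already refuted in dim ≥ 3. [folklore] -/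
theorem trace_piThree_sqrtNegThree_seven [IsCyclotomicExtension {21} ℚ K] (hζ : IsPrimitiveRoot ζ 21) :
    Algebra.trace ℚ K ((ζ ^ 17 * (1 - ζ ^ 7) * (1 - ζ) * (ζ ^ 5 * (aeval ζ (derivative (cyclotomic 21 ℚ)))⁻¹)) * (1 + 2 * ζ ^ 7) * (ζ + ζ⁻¹) ^ 7) = 42 := by
  have h21 : ζ ^ 21 = 1 := hζ.pow_eq_one
  have hΦ := cyc_twentyOne hζ
  rw [trace_of_key hζ (C (168 : ℚ) + C (-234 : ℚ) * X + C (192 : ℚ) * X ^ 2 + C (-63 : ℚ) * X ^ 3 + C (-63 : ℚ) * X ^ 4 +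
      C (21 : ℚ) * X ^ 5 + C (63 : ℚ) * X ^ 6 + C (21 : ℚ) * X ^ 7 + C (-150 : ℚ) * X ^ 8 + C (234 : ℚ) * X ^ 9 +
      C (-210 : ℚ) * X ^ 10 + C (42 : ℚ) * X ^ 11) (by compute_degree) (by
    rw [aeval_poly₁₂]
    push_cast
    linear_combination ((aeval ζ (derivative (cyclotomic 21 ℚ)))⁻¹ * (-77 - 5 * ζ - 77 * ζ^2 + 77 * ζ^3 - 44 * ζ^4 + 91 * ζ^5 - 21 * ζ^6 -
        14 * ζ^7 + 49 * ζ^8)) * hΦ +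
      ((aeval ζ (derivative (cyclotomic 21 ℚ)))⁻¹ * (-77 + 72 * ζ - 72 * ζ^2 + 77 * ζ^3 - 49 * ζ^4 + 63 * ζ^5 - 35 * ζ^6 +
        49 * ζ^7 - 36 * ζ^8 + 36 * ζ^9 - 28 * ζ^10 + 14 * ζ^11 - 14 * ζ^13 +
        28 * ζ^14 - 36 * ζ^15 + 36 * ζ^16 - 49 * ζ^17 + 35 * ζ^18 - 63 * ζ^19 +
        49 * ζ^20 - 77 * ζ^21 + 71 * ζ^22 - 71 * ζ^23 + 70 * ζ^24 - 42 * ζ^25 +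
        42 * ζ^26 - 14 * ζ^27 + 14 * ζ^28 - 2 * ζ^29 + 2 * ζ^30)) * h21)]
  norm_num [coeff_X_pow, coeff_X, coeff_C, coeff_one]

/-- `Tr(ζ′sθ^8) = -336` for `ζ′ = π₃ξ, π₃ = ζ¹⁷(1 − ζ⁷)(1 − ζ)`, `s = √−3 = 1 + 2ζ⁷`, `θ = ζ + ζ⁻¹` (Euler evaluation). research route conditional on HC_CM; not a corollary; Q11.4-sentence-2 already refuted in dim ≥ 3. [folklore] -/
theorem trace_piThree_sqrtNegThree_eight [IsCyclotomicExtension {21} ℚ K] (hζ : IsPrimitiveRoot ζ 21) :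
    Algebra.trace ℚ K ((ζ ^ 17 * (1 - ζ ^ 7) * (1 - ζ) * (ζ ^ 5 * (aeval ζ (derivative (cyclotomic 21 ℚ)))⁻¹)) * (1 + 2 * ζ ^ 7) * (ζ + ζ⁻¹) ^ 8) = -336 := by
  have h21 : ζ ^ 21 = 1 := hζ.pow_eq_one
  have hΦ := cyc_twentyOne hζ
  rw [trace_of_key hζ (C (-108 : ℚ) + C (402 : ℚ) * X + C (-465 : ℚ) * X ^ 2 + C (255 : ℚ) * X ^ 3 + C (0 : ℚ) * X ^ 4 +
      C (-168 : ℚ) * X ^ 5 + C (0 : ℚ) * X ^ 6 + C (81 : ℚ) * X ^ 7 + C (129 : ℚ) * X ^ 8 + C (-402 : ℚ) * X ^ 9 +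
      C (444 : ℚ) * X ^ 10 + C (-336 : ℚ) * X ^ 11) (by compute_degree) (by
    rw [aeval_poly₁₂]
    push_cast
    linear_combination ((aeval ζ (derivative (cyclotomic 21 ℚ)))⁻¹ * (-140 - 19 * ζ - 168 * ζ^2 + 121 * ζ^3 - 121 * ζ^4 + 168 * ζ^5 - 65 * ζ^6 +
        308 * ζ^7 + 84 * ζ^8)) * hΦ +
      ((aeval ζ (derivative (cyclotomic 21 ℚ)))⁻¹ * (-140 + 121 * ζ - 149 * ζ^2 + 149 * ζ^3 - 121 * ζ^4 + 140 * ζ^5 -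
        84 * ζ^6 + 112 * ζ^7 - 71 * ζ^8 + 85 * ζ^9 - 64 * ζ^10 + 50 * ζ^11 -
        28 * ζ^12 + 28 * ζ^14 - 50 * ζ^15 + 64 * ζ^16 - 85 * ζ^17 + 71 * ζ^18 -
        112 * ζ^19 + 84 * ζ^20 - 140 * ζ^21 + 120 * ζ^22 - 148 * ζ^23 +
        141 * ζ^24 - 113 * ζ^25 + 112 * ζ^26 - 56 * ζ^27 + 56 * ζ^28 - 16 * ζ^29 +
        16 * ζ^30 - 2 * ζ^31 + 2 * ζ^32)) * h21)]
  norm_num [coeff_X_pow, coeff_X, coeff_C, coeff_one]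

/-- `Tr(ζ′sθ^9) = 216` for `ζ′ = π₃ξ, π₃ = ζ¹⁷(1 − ζ⁷)(1 − ζ)`, `s = √−3 = 1 + 2ζ⁷`, `θ = ζ + ζ⁻¹` (Euler evaluation). research route conditional on HC_CM; not a corollary; Q11.4-sentence-2 already refuted in dim ≥ 3. [folklore] -/
theorem trace_piThree_sqrtNegThree_nine [IsCyclotomicExtension {21} ℚ K] (hζ : IsPrimitiveRoot ζ 21) :
    Algebra.trace ℚ K ((ζ ^ 17 * (1 - ζ ^ 7) * (1 - ζ) * (ζ ^ 5 * (aeval ζ (derivative (cyclotomic 21 ℚ)))⁻¹)) * (1 + 2 * ζ ^ 7) * (ζ + ζ⁻¹) ^ 9) = 216 := by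
  have h21 : ζ ^ 21 = 1 := hζ.pow_eq_one
  have hΦ := cyc_twentyOne hζ
  rw [trace_of_key hζ (C (630 : ℚ) + C (-909 : ℚ) * X + C (765 : ℚ) * X ^ 2 + C (-237 : ℚ) * X ^ 3 + C (-249 : ℚ) * X ^ 4 +
      C (108 : ℚ) * X ^ 5 + C (249 : ℚ) * X ^ 6 + C (21 : ℚ) * X ^ 7 + C (-549 : ℚ) * X ^ 8 +
      C (909 : ℚ) * X ^ 9 + C (-846 : ℚ) * X ^ 10 + C (216 : ℚ) * X ^ 11) (by compute_degree) (by
    rw [aeval_poly₁₂]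
    push_cast
    linear_combination ((aeval ζ (derivative (cyclotomic 21 ℚ)))⁻¹ * (-252 - 47 * ζ - 336 * ζ^2 + 186 * ζ^3 - 289 * ζ^4 + 289 * ζ^5 -
        186 * ζ^6 + 588 * ζ^7 - 61 * ζ^8)) * hΦ +
      ((aeval ζ (derivative (cyclotomic 21 ℚ)))⁻¹ * (-252 + 205 * ζ - 289 * ζ^2 + 270 * ζ^3 - 270 * ζ^4 + 289 * ζ^5 -
        205 * ζ^6 + 252 * ζ^7 - 155 * ζ^8 + 197 * ζ^9 - 135 * ζ^10 + 135 * ζ^11 -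
        92 * ζ^12 + 50 * ζ^13 - 50 * ζ^15 + 92 * ζ^16 - 135 * ζ^17 + 135 * ζ^18 -
        197 * ζ^19 + 155 * ζ^20 - 252 * ζ^21 + 204 * ζ^22 - 288 * ζ^23 +
        261 * ζ^24 - 261 * ζ^25 + 253 * ζ^26 - 169 * ζ^27 + 168 * ζ^28 -
        72 * ζ^29 + 72 * ζ^30 - 18 * ζ^31 + 18 * ζ^32 - 2 * ζ^33 + 2 * ζ^34)) * h21)]
  norm_num [coeff_X_pow, coeff_X, coeff_C, coeff_one]

/-- `Tr(ζ′sθ^10) = -1260` for `ζ′ = π₃ξ, π₃ = ζ¹⁷(1 − ζ⁷)(1 − ζ)`, `s = √−3 = 1 + 2ζ⁷`, `θ = ζ + ζ⁻¹` (Euler evaluation). research route conditional on HC_CM; not a corollary; Q11.4-sentence-2 already refuted in dim ≥ 3. [folklore] -/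
theorem trace_piThree_sqrtNegThree_ten [IsCyclotomicExtension {21} ℚ K] (hζ : IsPrimitiveRoot ζ 21) :
    Algebra.trace ℚ K ((ζ ^ 17 * (1 - ζ ^ 7) * (1 - ζ) * (ζ ^ 5 * (aeval ζ (derivative (cyclotomic 21 ℚ)))⁻¹)) * (1 + 2 * ζ ^ 7) * (ζ + ζ⁻¹) ^ 10) = -1260 := by
  have h21 : ζ ^ 21 = 1 := hζ.pow_eq_one
  have hΦ := cyc_twentyOne hζ
  rw [trace_of_key hζ (C (-495 : ℚ) + C (1611 : ℚ) * X + C (-1776 : ℚ) * X ^ 2 + C (930 : ℚ) * X ^ 3 + C (87 : ℚ) * X ^ 4 +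
      C (-630 : ℚ) * X ^ 5 + C (-87 : ℚ) * X ^ 6 + C (330 : ℚ) * X ^ 7 + C (516 : ℚ) * X ^ 8 +
      C (-1611 : ℚ) * X ^ 9 + C (1755 : ℚ) * X ^ 10 + C (-1260 : ℚ) * X ^ 11) (by compute_degree) (by
    rw [aeval_poly₁₂]
    push_cast
    linear_combination ((aeval ζ (derivative (cyclotomic 21 ℚ)))⁻¹ * (811 + 1171 * ζ + 630 * ζ^2 + 294 * ζ^3 - 625 * ζ^4 + 475 * ζ^5 -
        475 * ζ^6 - 186 * ζ^7 - 1465 * ζ^8)) * hΦ +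
      ((aeval ζ (derivative (cyclotomic 21 ℚ)))⁻¹ * (811 + 360 * ζ - 541 * ζ^2 + 475 * ζ^3 - 559 * ζ^4 + 559 * ζ^5 -
        475 * ζ^6 + 541 * ζ^7 - 360 * ζ^8 + 449 * ζ^9 - 290 * ζ^10 + 332 * ζ^11 -
        227 * ζ^12 + 185 * ζ^13 - 92 * ζ^14 + 92 * ζ^16 - 185 * ζ^17 +
        227 * ζ^18 - 332 * ζ^19 + 290 * ζ^20 - 449 * ζ^21 + 359 * ζ^22 -
        540 * ζ^23 + 465 * ζ^24 - 549 * ζ^25 + 514 * ζ^26 - 430 * ζ^27 +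
        421 * ζ^28 - 241 * ζ^29 + 240 * ζ^30 - 90 * ζ^31 + 90 * ζ^32 - 20 * ζ^33 +
        20 * ζ^34 - 2 * ζ^35 + 2 * ζ^36)) * h21)]
  norm_num [coeff_X_pow, coeff_X, coeff_C, coeff_one]

/-- **The Gram datum `a` of `(E_ζ′, s)` in the real frame `θ^i` (`i < 6`)** for `ζ′ = π₃ξ, π₃ = ζ¹⁷(1 − ζ⁷)(1 − ζ)` (type 𝔮₃: `𝔬𝔣₀ = (π₃)`, `(𝔬𝔣₀)² = (3)`, degree 27),
`s = √−3 = 1 + 2ζ⁷`: the integer Hankel matrix `(−Tr(ζ′sθ^{i+j}))ᵢⱼ` (and `b = 0`, part 82 `hb_eq_zero`).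
research route conditional on HC_CM; not a corollary; Q11.4-sentence-2 already refuted in dim ≥ 3. [cite: vanGeemen1994HodgeAV, Lemma 5.2 (2)–(3)] -/
theorem realPart_piThree_sqrtNegThree [IsCyclotomicExtension {21} ℚ K] [IsCMField K] (hζ : IsPrimitiveRoot ζ 21)
    {x : Fin 6 → K} (hx : ∀ i, x i = (ζ + ζ⁻¹) ^ (i : ℕ)) {a : Matrix (Fin 6) (Fin 6) ℚ}
    (ha : ∀ i j, a i j = Algebra.trace ℚ K ((ζ ^ 17 * (1 - ζ ^ 7) * (1 - ζ) * (ζ ^ 5 * (aeval ζ (derivative (cyclotomic 21 ℚ)))⁻¹)) * x i * IsCMField.complexConj K ((1 + 2 * ζ ^ 7) * x j))) :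
    a = !![0, 0, 6, 0, 24, -6; 0, 6, 0, 24, -6, 90; 6, 0, 24, -6, 90, -42; 0, 24, -6, 90, -42, 336; 24, -6, 90, -42, 336, -216; -6, 90, -42, 336, -216, 1260] := by
  rw [ha_eq (complexConj_sqrtNegThree hζ) (complexConj_thetaFrame hζ hx) ha]
  ext i j
  simp only [Matrix.of_apply, hx, ← pow_add]
  fin_cases i <;> fin_cases j <;> simp [trace_piThree_sqrtNegThree_zero hζ, trace_piThree_sqrtNegThree_one hζ, trace_piThree_sqrtNegThree_two hζ, trace_piThree_sqrtNegThree_three hζ, trace_piThree_sqrtNegThree_four hζ, trace_piThree_sqrtNegThree_five hζ,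
    trace_piThree_sqrtNegThree_six hζ, trace_piThree_sqrtNegThree_seven hζ, trace_piThree_sqrtNegThree_eight hζ, trace_piThree_sqrtNegThree_nine hζ, trace_piThree_sqrtNegThree_ten hζ]

/-- **`det a = -46656`** for `ζ′ = π₃ξ, π₃ = ζ¹⁷(1 − ζ⁷)(1 − ζ)`, `s = √−3 = 1 + 2ζ⁷` (frame `θ^i`, `i < 6`). research route conditional on HC_CM; not a corollary; Q11.4-sentence-2 already refuted in dim ≥ 3. [cite: vanGeemen1994HodgeAV, Lemma 5.2 (3)] -/
theorem det_realPart_piThree_sqrtNegThree [IsCyclotomicExtension {21} ℚ K] [IsCMField K] (hζ : IsPrimitiveRoot ζ 21)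
    {x : Fin 6 → K} (hx : ∀ i, x i = (ζ + ζ⁻¹) ^ (i : ℕ)) {a : Matrix (Fin 6) (Fin 6) ℚ}
    (ha : ∀ i j, a i j = Algebra.trace ℚ K ((ζ ^ 17 * (1 - ζ ^ 7) * (1 - ζ) * (ζ ^ 5 * (aeval ζ (derivative (cyclotomic 21 ℚ)))⁻¹)) * x i * IsCMField.complexConj K ((1 + 2 * ζ ^ 7) * x j))) :
    a.det = -46656 := by
  rw [realPart_piThree_sqrtNegThree hζ hx ha]
  simp [Matrix.det_succ_row_zero, Fin.sum_univ_succ, Fin.succAbove, Matrix.submatrix]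
  norm_num

/-! ### §2 Invariance, census form, class: SPLIT (row R0 / W6.3.1) -/

/-- **For EVERY skew `ζ′` of type 𝔮₃ (degree `27`) on `ℤ[ζ_21]` (`IsOfType 1 ζ′ 𝔣₀`, `𝔬𝔣₀ = (π)`, `(𝔬𝔣₀)² = (3)`, degree `27`; `ζ′ = u·πξ`,
`u` a real unit of norm `1` by THEOREM L (i) at `21`) the Gram determinant of `(E_ζ′, s₃)` in the frame `θ^i` is `-46656`**
(they exist on every `ℚ(√−3)`-balanced `Φ`, part 49a): the SPLIT row R0 for `ℚ(√−3)` (census W6.3.1 `= (3, ℚ(√−3), 1)`).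
research route conditional on HC_CM; not a corollary; Q11.4-sentence-2 already refuted in dim ≥ 3. [cite: vanGeemen1994HodgeAV, Lemma 5.2 (3)–(4) and (5.4.1)] [cite: Shimura1998, §14.3 Prop. 4–5, pp. 103–104] -/
theorem det_realPart_typeThree_sqrtNegThree [IsCyclotomicExtension {21} ℚ K] [IsCMField K]
    (hζ : IsPrimitiveRoot ζ 21) {𝔣₀ : Ideal (𝓞 (maximalRealSubfield K))}
    (h𝔣₀ : 𝔣₀.map (algebraMap (𝓞 (maximalRealSubfield K)) (𝓞 K)) = Ideal.span {hζ.toInteger ^ 17 * (1 - hζ.toInteger ^ 7) * (1 - hζ.toInteger ^ 1)})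
    {ζ' : K} (hζ' : IsCMField.complexConj K ζ' = -ζ')
    (hT : CMTypeLattice.IsOfType (1 : (FractionalIdeal (𝓞 K)⁰ K)ˣ) ζ' 𝔣₀)
    {x : Fin 6 → K} (hx : ∀ i, x i = (ζ + ζ⁻¹) ^ (i : ℕ)) {a : Matrix (Fin 6) (Fin 6) ℚ}
    (ha : ∀ i j, a i j = Algebra.trace ℚ K (ζ' * x i * IsCMField.complexConj K ((1 + 2 * ζ ^ 7) * x j))) :
    a.det = -46656 := by
  obtain ⟨ωb, hωb⟩ := exists_basis_thetaPow hζ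
  have hx' : ∀ i, x i = (ωb i : K) := fun i => (hx i).trans (hωb i).symm
  have hg : Nat.totient 21 = 2 * (5 + 1) := by decide
  have hsk : IsCMField.complexConj K (ζ ^ 17 * (1 - ζ ^ 7) * (1 - ζ) * (ζ ^ 5 * (aeval ζ (derivative (cyclotomic 21 ℚ)))⁻¹)) =
      -(ζ ^ 17 * (1 - ζ ^ 7) * (1 - ζ) * (ζ ^ 5 * (aeval ζ (derivative (cyclotomic 21 ℚ)))⁻¹)) := by
    simpa only [pow_one] using complexConj_gen_mul_xi hζ hg adm_twentyOne
  have h0 : (ζ ^ 17 * (1 - ζ ^ 7) * (1 - ζ) * (ζ ^ 5 * (aeval ζ (derivative (cyclotomic 21 ℚ)))⁻¹)) ≠ 0 :=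
    mul_ne_zero (by simpa only [pow_one] using gen_ne_zero hζ adm_twentyOne) (xi_ne_zero hζ 5)
  have hT₀ : CMTypeLattice.IsOfType (1 : (FractionalIdeal (𝓞 K)⁰ K)ˣ) (ζ ^ 17 * (1 - ζ ^ 7) * (1 - ζ) * (ζ ^ 5 * (aeval ζ (derivative (cyclotomic 21 ℚ)))⁻¹)) 𝔣₀ := by
    simpa only [pow_one] using isOfType_one_gen_mul_xi hζ 5 ((7, 1, 17) : ℕ × ℕ × ℕ) h𝔣₀
  rw [det_realPart_eq_of_isOfType ωb (complexConj_sqrtNegThree hζ) hx' (norm_realUnits_pos_twentyOne hζ)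
    hsk h0 hζ' hT₀ hT (fun i j => rfl) ha]
  exact det_realPart_piThree_sqrtNegThree hζ hx (fun i j => rfl)

open scoped Classical in
/-- **CENSUS FORM** (part 49a's existence + the determinant): for every CM type `Φ` of `ℚ(ζ_21)` balanced for `N_K = {2, 5, 8, 11, 17, 20}` (Weil signature `(3,3)`
for `K_d = ℚ(√−3)`) and the type `𝔣₀` above, `ℂ^Φ/Φ(ℤ[ζ_21])` carries a `Φ`-positive divisor of type `(K; Φ; 𝔣₀)`, and
EVERY such divisor `X_ζ′` has van Geemen Gram determinant `-46656` in the real frame `θ^i`: the SPLIT row R0 for `ℚ(√−3)` (census W6.3.1 `= (3, ℚ(√−3), 1)`).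
research route conditional on HC_CM; not a corollary; Q11.4-sentence-2 already refuted in dim ≥ 3. [cite: vanGeemen1994HodgeAV, Lemma 5.2 (3)–(4) and (5.4.1)] [cite: Shimura1998, §14.3 Prop. 4–5, pp. 103–104] -/
theorem exists_typeThree_sqrtNegThree_det [IsCyclotomicExtension {21} ℚ K] [IsCMField K]
    (hζ : IsPrimitiveRoot ζ 21) (Φ : CMType K)
    (hbal : 2 * (SΦ[Φ, ζ] ∩ ({2, 5, 8, 11, 17, 20} : Finset (ZMod 21))).card = (SΦ[Φ, ζ]).card)
    {𝔣₀ : Ideal (𝓞 (maximalRealSubfield K))}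
    (h𝔣₀ : 𝔣₀.map (algebraMap (𝓞 (maximalRealSubfield K)) (𝓞 K)) =
      Ideal.span {hζ.toInteger ^ 17 * (1 - hζ.toInteger ^ 7) * (1 - hζ.toInteger ^ 1)}) :
    ∃ ζ' : K, IsCMField.complexConj K ζ' = -ζ' ∧ (∀ φ : Φ.1, 0 < (φ.1 ζ').im) ∧
      CMTypeLattice.IsOfType (1 : (FractionalIdeal (𝓞 K)⁰ K)ˣ) ζ' 𝔣₀ ∧
      ∀ (x : Fin 6 → K), (∀ i, x i = (ζ + ζ⁻¹) ^ (i : ℕ)) → ∀ a : Matrix (Fin 6) (Fin 6) ℚ,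
        (∀ i j, a i j = Algebra.trace ℚ K (ζ' * x i * IsCMField.complexConj K ((1 + 2 * ζ ^ 7) * x j))) →
        a.det = -46656 := by
  obtain ⟨ζ', h1, h2, h3⟩ := exists_type_twentyOne_sqrt_neg_three hζ Φ hbal h𝔣₀
  exact ⟨ζ', h1, h2, h3, fun x hx a ha => det_realPart_typeThree_sqrtNegThree hζ h𝔣₀ h1 h3 hx ha⟩

/-- **`[-46656] = [−1]·[46656]` is the SPLIT class `splitDiscriminantClass 3 3` in `ℚˣ/Nm(ℚ(√−3)ˣ)`** (`46656 = 216² + 3·0² ∈ Nm`):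
the type-`𝔮₃` (degree `27`) polarised Weil-type `ℤ[ζ₂₁]`-CM sixfolds lie on the SPLIT row R0 for `ℚ(√−3)` (census W6.3.1 `= (3, ℚ(√−3), 1)`).
research route conditional on HC_CM; not a corollary; Q11.4-sentence-2 already refuted in dim ≥ 3. [cite: vanGeemen1994HodgeAV, 5.4 and (5.4.1)] -/
theorem mk0_det_typeThree_sqrtNegThree :
    (QuotientGroup.mk (Units.mk0 (-46656 : ℚ) (by norm_num)) : weilNormResidueGroup 3) = splitDiscriminantClass 3 3 :=
  mk_neg_eq_split_of_odd (by decide) (by norm_num : (46656 : ℚ) ≠ 0)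
    (mem_normUnitsSubgroup_of_sq_add_mul_sq _ (216 : ℚ) (0 : ℚ) (by norm_num))

end Summit.HodgeConjecture.Ring2WeilCoverage.WeilGramLevel21TypeThree

end
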